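import Mathlib
import Summits.ValiantsHypothesis.ValiantsHypothesis.Theorems.KPlusLogSqLawWeakLiftingTowerGraftRoucheDisc
import Summits.ValiantsHypothesis.ValiantsHypothesis.Theorems.KPlusLogSqLawWeakLiftingTowerGraftEventLocalisation

/-!
# Tower graft line — T1 IN GENERAL: crossings of the steep arc are charged to CLUSTER DISCS of near-axis roots (Rouché)

Mechanism file for the line `Cruxes/WeakLifting/Lines/tower_graft.lean` (crux `WeakLifting` = stmt-ValiantsHypothesis-19561,
memo `tower_graft-S5.md` §3 T1 «log-slope localisation»; this seat's memo `HOME/val-sym-lift-p1/g20/memo/T1-CORNER-liftp1g20.md` §5).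
NO stub is claimed.

THE THEOREMS (`card_posRoots_add_X_pow_mul_le_of_rouche_discs` = SHARP interface: discs supplied WITH their Rouché inequality; `card_posRoots_add_X_pow_mul_le_of_discs` = the clearance packaging, T1 in general).  `A, E ∈ ℝ[X]` non-zero, `n = deg A + deg E`, `D > 4n`,
`4n ≤ s·D` (`0 < s ≤ 1`), `W = X(A′E − AE′) − D·AE` the Rolle–Schur residual of the graft `h = A + X^D·E`.  Let finitely many discs
`B(cᵢ, Rᵢ)` be given such that (CLEARANCE) every complex root `z` of `A·E` keeps distance `≥ 4(n/D)·‖z‖` from every circle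
`|τ − cᵢ| = Rᵢ`, and (COVERAGE) every real `t > 0` within `4(n/D)·‖z‖` of an IN-SECTOR root `z` (`¬(s‖z‖ ≤ |Im z| ∨ Re z ≤ 0)`) lies in
some disc.  Then
`Z₊(A + X^D·E) ≤ 2·Σᵢ #{distinct roots of A·E in B(cᵢ,Rᵢ)} + Z₊(E) + 1`.
Route: `RolleSchur.posRoots_le_scalar` (tree) ⇒ `Z₊(h) ≤ Z₊(W) + Z₊(E) + 1 + #common`; a positive root of `W` is a root of `A·E`
(in-sector, hence covered) or a zero of the log-slope potential, which sits within `2(n/D)t` of an in-sector root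
(`exists_inSector_root_near_of_residual_zero`), hence in a disc; inside ONE disc, ROUCHÉ (`card_roots_filter_ball_eq_of_norm_lt`, against
`−D·A·E`: on the circle `Σ_z |τ/(τ − z)| ≤ D/2 + 2n < D` by clearance) equates the root counts of `W` and `A·E`, and `W` vanishes to order
`≥ m − 1` at every root of `A·E` of multiplicity `m`, so the zeros of `W` off `A·E` in the disc number at most the DISTINCT roots of `A·E`
there (`card_real_zeros_residual_le_in_disc`).
READING for S4b/S5 (corner graft `det G + X^D det G₀₀` on a steep tower): every crossing of the arc is charged twice to a near-axis root of the
class determinants `det G · det G₀₀`, cluster disc by cluster disc; what the CLASS must pay (T2) is the number of distinct roots in such a disc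
system — real roots are ≤ 2B by the class budget, the non-real near-axis ones are the open object.
HONEST FRAMING: real/complex analysis of two polynomials and a monomial arc; the disc system is a HYPOTHESIS (its existence with
`Σᵢ #roots = |10ρ-chain hull of the in-sector roots|` is elementary geometry, memo §5 (b), not typed here); nothing on S4/S4b/S5, TowerB,
`WeakLifting`, B, 18050 or `VP ≠ VNP`.  Def-free.  Seat: prover val-sym-lift-p1 g20, `--supports stmt-ValiantsHypothesis-19561`.
-/

-- `Summit.ValiantsHypothesis.ValiantsHypothesis.…` repeats a component by the D-0017 layout
-- (single-conjunct summit), which the `dupNamespace` linter flags; the name is mandated.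
set_option linter.dupNamespace false

namespace Summit.ValiantsHypothesis.ValiantsHypothesis.Theorems.KPlusLogSqLaw.TowerGraft

open Polynomial Complex
open scoped BigOperators Polynomial Real

/-! ## §3 The Rouché inequality on a circle with clearance from the roots -/

section Clearance

/-- one term: if `‖τ − z‖ ≥ 4ρ‖z‖` with `0 < ρ ≤ 1/4` then `‖τ/(τ − z)‖ ≤ 1/(2ρ)`. [folklore] -/
theorem norm_div_sub_le_of_clearance {τ z : ℂ} {ρ : ℝ} (hρ : 0 < ρ) (hρ1 : ρ ≤ 1 / 4)
    (hz : 4 * ρ * ‖z‖ ≤ ‖τ - z‖) : ‖τ / (τ - z)‖ ≤ 1 / (2 * ρ) := by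
  have h2 : (2 : ℝ) ≤ 1 / (2 * ρ) := by
    rw [le_div_iff₀ (by positivity)]; nlinarith
  by_cases hτz : τ - z = 0
  · rw [hτz, div_zero, norm_zero]; positivity
  have hpos : 0 < ‖τ - z‖ := norm_pos_iff.mpr hτz
  rw [norm_div, div_le_iff₀ hpos]
  by_cases hcase : ‖τ‖ ≤ 2 * ‖z‖
  · -- `‖τ‖ ≤ 2‖z‖ ≤ (1/(2ρ))·4ρ‖z‖ ≤ (1/(2ρ))‖τ − z‖`
    calc ‖τ‖ ≤ 2 * ‖z‖ := hcase
      _ = 1 / (2 * ρ) * (4 * ρ * ‖z‖) := by field_simp; ring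
      _ ≤ 1 / (2 * ρ) * ‖τ - z‖ := mul_le_mul_of_nonneg_left hz (by positivity)
  · -- `‖τ‖ > 2‖z‖`: `‖τ − z‖ ≥ ‖τ‖ − ‖z‖ > ‖τ‖/2`
    push Not at hcase
    have h3 : ‖τ‖ - ‖z‖ ≤ ‖τ - z‖ := norm_sub_norm_le τ z
    nlinarith [norm_nonneg z, norm_nonneg τ]

/-- **THE ROUCHÉ INEQUALITY FROM A ROOT-SUM BOUND (sharp interface).**  Let `A, E ∈ ℝ[X]` be non-zero and `τ ∈ ℂ` not a root of
`A·E`.  If `‖Σ_{z ∈ roots A} τ/(τ − z) − Σ_{w ∈ roots E} τ/(τ − w)‖ < D` then the complexified residual `W = X(A′E − AE′) − D·AE`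
satisfies `‖W(τ) + D·A(τ)E(τ)‖ < ‖D·A(τ)E(τ)‖` (indeed `W + D·AE = X(A′E − AE′) = AE·(Σ_A − Σ_E)`).  This is the hypothesis of
`card_real_zeros_residual_le_in_disc`; a consumer with finer near/far estimates of the root sums uses this lemma directly. [this work] -/
theorem rouche_ineq_of_rootSum_norm_lt (A E : ℝ[X]) (D : ℕ) {τ : ℂ}
    (hAτ : (A.map Complex.ofRealHom).eval τ ≠ 0) (hEτ : (E.map Complex.ofRealHom).eval τ ≠ 0)
    (hsum : ‖((A.map Complex.ofRealHom).roots.map fun z => τ / (τ - z)).sum -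
        ((E.map Complex.ofRealHom).roots.map fun z => τ / (τ - z)).sum‖ < D) :
    ‖((X * (derivative A * E - A * derivative E) - C (D : ℝ) * (A * E)).map Complex.ofRealHom +
        C (D : ℂ) * ((A * E).map Complex.ofRealHom)).eval τ‖ <
      ‖(C (D : ℂ) * ((A * E).map Complex.ofRealHom)).eval τ‖ := by
  set Ac := A.map Complex.ofRealHom with hAc
  set Ec := E.map Complex.ofRealHom with hEc
  -- log-derivative formulas at the complex point `τ`
  have hLA := (IsAlgClosed.splits Ac).eval_derivative_div_eval_of_ne_zero hAτ
  have hLE := (IsAlgClosed.splits Ec).eval_derivative_div_eval_of_ne_zero hEτ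
  have hdA : Ac.derivative = A.derivative.map Complex.ofRealHom := by rw [hAc, Polynomial.derivative_map]
  have hdE : Ec.derivative = E.derivative.map Complex.ofRealHom := by rw [hEc, Polynomial.derivative_map]
  rw [hdA] at hLA
  rw [hdE] at hLE
  have e1 : (Ac.roots.map fun z => τ / (τ - z)).sum = τ * ((A.derivative.map Complex.ofRealHom).eval τ / Ac.eval τ) := by
    rw [hLA, ← Multiset.sum_map_mul_left]
    exact congrArg _ (Multiset.map_congr rfl fun z _ => by rw [← div_eq_mul_one_div])
  have e2 : (Ec.roots.map fun z => τ / (τ - z)).sum = τ * ((E.derivative.map Complex.ofRealHom).eval τ / Ec.eval τ) := by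
    rw [hLE, ← Multiset.sum_map_mul_left]
    exact congrArg _ (Multiset.map_congr rfl fun z _ => by rw [← div_eq_mul_one_div])
  -- the value of `W + D·AE` at `τ`
  have hval : ((X * (derivative A * E - A * derivative E) - C (D : ℝ) * (A * E)).map Complex.ofRealHom +
      C (D : ℂ) * ((A * E).map Complex.ofRealHom)).eval τ =
      (Ac.eval τ * Ec.eval τ) * ((Ac.roots.map fun z => τ / (τ - z)).sum - (Ec.roots.map fun z => τ / (τ - z)).sum) := by
    rw [e1, e2]
    simp only [Polynomial.map_sub, Polynomial.map_mul, Polynomial.map_X, Polynomial.map_C,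
      eval_add, eval_sub, eval_mul, eval_X, eval_C, Complex.ofRealHom_eq_coe, Complex.ofReal_natCast]
    simp only [← hAc, ← hEc]
    field_simp
    ring
  have hval2 : (C (D : ℂ) * ((A * E).map Complex.ofRealHom)).eval τ = (D : ℂ) * (Ac.eval τ * Ec.eval τ) := by
    simp only [Polynomial.map_mul, eval_mul, eval_C, ← hAc, ← hEc]
  have hAE0 : 0 < ‖Ac.eval τ * Ec.eval τ‖ := norm_pos_iff.mpr (mul_ne_zero hAτ hEτ)
  rw [hval, hval2, norm_mul (Ac.eval τ * Ec.eval τ), norm_mul (D : ℂ), Complex.norm_natCast, mul_comm]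
  exact mul_lt_mul_of_pos_right hsum hAE0

/-- **THE ROUCHÉ INEQUALITY FROM CLEARANCE (crude packaging).**  Let `A, E ∈ ℝ[X]` be non-zero, `n = deg A + deg E`, `0 < D`,
`4n ≤ D`.  At every `τ ≠ 0` keeping distance `≥ 4(n/D)‖z‖` from every complex root `z` of `A·E`, the Rouché inequality of
`rouche_ineq_of_rootSum_norm_lt` holds — every term `τ/(τ − z)` is `≤ D/(2n)` (`norm_div_sub_le_of_clearance`).  Calibration (lift-p3 g18 /
crit-6 READ #62): a clearance proportional to `(n/D)‖z‖` cannot separate a cyclotomic cloud of `N` roots (`2π/N`-spaced) unless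
`D ≳ nN`, so THIS packaging is informative only at quadratic steepness; finer near/far root-sum estimates go through the sharp interface.
[this work] -/
theorem rouche_ineq_of_clearance (A E : ℝ[X]) (hA : A ≠ 0) (hE : E ≠ 0) {D : ℕ} (hD0 : 0 < D)
    (hnD : 4 * ((A.natDegree : ℝ) + E.natDegree) ≤ D) {τ : ℂ} (hτ0 : τ ≠ 0)
    (hclear : ∀ z ∈ (A.map Complex.ofRealHom).roots + (E.map Complex.ofRealHom).roots,
      4 * (((A.natDegree : ℝ) + E.natDegree) / D) * ‖z‖ ≤ ‖τ - z‖) :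
    ‖((X * (derivative A * E - A * derivative E) - C (D : ℝ) * (A * E)).map Complex.ofRealHom +
        C (D : ℂ) * ((A * E).map Complex.ofRealHom)).eval τ‖ <
      ‖(C (D : ℂ) * ((A * E).map Complex.ofRealHom)).eval τ‖ := by
  set Ac := A.map Complex.ofRealHom with hAc
  set Ec := E.map Complex.ofRealHom with hEc
  set n : ℝ := (A.natDegree : ℝ) + E.natDegree with hn
  have hAc0 : Ac ≠ 0 := (Polynomial.map_ne_zero_iff Complex.ofRealHom.injective).mpr hA
  have hEc0 : Ec ≠ 0 := (Polynomial.map_ne_zero_iff Complex.ofRealHom.injective).mpr hE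
  have hD0' : (0 : ℝ) < D := by exact_mod_cast hD0
  have hcardA : (Multiset.card Ac.roots : ℝ) = A.natDegree := by
    rw [hAc, ← (IsAlgClosed.splits (A.map Complex.ofRealHom)).natDegree_eq_card_roots,
      Polynomial.natDegree_map_eq_of_injective Complex.ofRealHom.injective]
  have hcardE : (Multiset.card Ec.roots : ℝ) = E.natDegree := by
    rw [hEc, ← (IsAlgClosed.splits (E.map Complex.ofRealHom)).natDegree_eq_card_roots,
      Polynomial.natDegree_map_eq_of_injective Complex.ofRealHom.injective]
  have hnpos : ∀ z ∈ Ac.roots + Ec.roots, 0 < n := by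
    intro z hz
    have hc : (0 : ℝ) < Multiset.card (Ac.roots + Ec.roots) := by
      exact_mod_cast Multiset.card_pos_iff_exists_mem.mpr ⟨z, hz⟩
    rw [Multiset.card_add, Nat.cast_add, hcardA, hcardE] at hc
    rw [hn]; exact hc
  -- `τ` is not a root
  have hnotroot : ∀ z ∈ Ac.roots + Ec.roots, τ ≠ z := by
    intro z hz hτz
    have h := hclear z hz
    rw [hτz, sub_self, norm_zero] at h
    have hz0 : z ≠ 0 := hτz ▸ hτ0
    have : 0 < 4 * (n / D) * ‖z‖ :=
      mul_pos (mul_pos four_pos (div_pos (hnpos z hz) hD0')) (norm_pos_iff.mpr hz0)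
    linarith
  have hAct : Ac.eval τ ≠ 0 := fun h0 =>
    hnotroot τ (Multiset.mem_add.mpr (Or.inl ((Polynomial.mem_roots hAc0).mpr h0))) rfl
  have hEct : Ec.eval τ ≠ 0 := fun h0 =>
    hnotroot τ (Multiset.mem_add.mpr (Or.inr ((Polynomial.mem_roots hEc0).mpr h0))) rfl
  -- every term is `≤ D/(2n)`
  have hterm : ∀ z ∈ Ac.roots + Ec.roots, ‖τ / (τ - z)‖ ≤ D / (2 * n) := by
    intro z hz
    have hn1 := hnpos z hz
    have h := norm_div_sub_le_of_clearance (div_pos hn1 hD0') (by rw [div_le_iff₀ hD0']; linarith) (hclear z hz)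
    rwa [show 1 / (2 * (n / D)) = D / (2 * n) by field_simp] at h
  have hsumA : ‖(Ac.roots.map fun z => τ / (τ - z)).sum‖ ≤ Multiset.card Ac.roots * (D / (2 * n)) := by
    calc ‖(Ac.roots.map fun z => τ / (τ - z)).sum‖
        ≤ ((Ac.roots.map fun z => τ / (τ - z)).map fun x => ‖x‖).sum := norm_multiset_sum_le _
      _ = (Ac.roots.map fun z => ‖τ / (τ - z)‖).sum := by rw [Multiset.map_map]; rfl
      _ ≤ (Ac.roots.map fun _ => (D : ℝ) / (2 * n)).sum :=
          Multiset.sum_map_le_sum_map _ _ fun z hz => hterm z (Multiset.mem_add.mpr (Or.inl hz))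
      _ = Multiset.card Ac.roots * (D / (2 * n)) := by
          rw [Multiset.map_const', Multiset.sum_replicate, nsmul_eq_mul]
  have hsumE : ‖(Ec.roots.map fun z => τ / (τ - z)).sum‖ ≤ Multiset.card Ec.roots * (D / (2 * n)) := by
    calc ‖(Ec.roots.map fun z => τ / (τ - z)).sum‖
        ≤ ((Ec.roots.map fun z => τ / (τ - z)).map fun x => ‖x‖).sum := norm_multiset_sum_le _
      _ = (Ec.roots.map fun z => ‖τ / (τ - z)‖).sum := by rw [Multiset.map_map]; rfl
      _ ≤ (Ec.roots.map fun _ => (D : ℝ) / (2 * n)).sum :=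
          Multiset.sum_map_le_sum_map _ _ fun z hz => hterm z (Multiset.mem_add.mpr (Or.inr hz))
      _ = Multiset.card Ec.roots * (D / (2 * n)) := by
          rw [Multiset.map_const', Multiset.sum_replicate, nsmul_eq_mul]
  refine rouche_ineq_of_rootSum_norm_lt A E D hAct hEct ?_
  have hle : ‖(Ac.roots.map fun z => τ / (τ - z)).sum - (Ec.roots.map fun z => τ / (τ - z)).sum‖ ≤
      n * (D / (2 * n)) := by
    calc ‖(Ac.roots.map fun z => τ / (τ - z)).sum - (Ec.roots.map fun z => τ / (τ - z)).sum‖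
        ≤ ‖(Ac.roots.map fun z => τ / (τ - z)).sum‖ + ‖(Ec.roots.map fun z => τ / (τ - z)).sum‖ := norm_sub_le _ _
      _ ≤ Multiset.card Ac.roots * (D / (2 * n)) + Multiset.card Ec.roots * (D / (2 * n)) := add_le_add hsumA hsumE
      _ = n * (D / (2 * n)) := by rw [hcardA, hcardE, hn]; ring
  refine hle.trans_lt ?_
  by_cases hn0 : n = 0
  · rw [hn0, zero_mul]; exact hD0'
  · have hn1 : 0 < n := lt_of_le_of_ne (by positivity) (Ne.symm hn0)
    rw [show n * (D / (2 * n)) = D / 2 by field_simp]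
    linarith

end Clearance


/-! ## §4 T1 in general: the crossing count charged to a disc system -/

section Assembly

/-- **T1 IN GENERAL (log-slope localisation, charged to cluster discs).**  `A, E ∈ ℝ[X]` non-zero, `0 < s ≤ 1`, `0 < D`,
`4(deg A + deg E) ≤ s·D`; discs `B(ctr i, rad i)` (`i ∈ I`, `rad i > 0`, circles avoiding `0`) with CLEARANCE (every complex root `z`
of `A·E` is `≥ 4((deg A + deg E)/D)·‖z‖` away from every circle) and COVERAGE (every real `t > 0` within `4((deg A+deg E)/D)·‖z‖` of an
in-sector root `z` lies in some disc).  Then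
`Z₊(A + X^D·E) ≤ 2·Σᵢ #{distinct roots of A·E in disc i} + 2·Z₊(E) + 1`. [this work] -/
theorem card_posRoots_add_X_pow_mul_le_of_discs {s : ℝ} (hs : 0 < s) (hs1 : s ≤ 1) (A E : ℝ[X]) {D : ℕ} (hD : 0 < D)
    (hA : A ≠ 0) (hE : E ≠ 0) (hdeg : 4 * ((A.natDegree : ℝ) + E.natDegree) ≤ s * D)
    {ι : Type*} (I : Finset ι) (ctr : ι → ℂ) (rad : ι → ℝ) (hrad : ∀ i ∈ I, 0 < rad i)
    (h0 : ∀ i ∈ I, ∀ τ ∈ Metric.sphere (ctr i) (rad i), τ ≠ 0)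
    (hclear : ∀ i ∈ I, ∀ τ ∈ Metric.sphere (ctr i) (rad i),
      ∀ z ∈ (A.map Complex.ofRealHom).roots + (E.map Complex.ofRealHom).roots,
        4 * (((A.natDegree : ℝ) + E.natDegree) / D) * ‖z‖ ≤ ‖τ - z‖)
    (hcover : ∀ z ∈ (A.map Complex.ofRealHom).roots + (E.map Complex.ofRealHom).roots,
      ¬ (s * ‖z‖ ≤ |z.im| ∨ z.re ≤ 0) → ∀ t : ℝ, 0 < t →
        ‖(t : ℂ) - z‖ ≤ 4 * (((A.natDegree : ℝ) + E.natDegree) / D) * ‖z‖ → ∃ i ∈ I, dist (t : ℂ) (ctr i) < rad i) :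
    ((A + X ^ D * E).roots.toFinset.filter (fun t => 0 < t)).card ≤
      2 * ∑ i ∈ I, (((A * E).map Complex.ofRealHom).roots.filter fun z => dist z (ctr i) < rad i).toFinset.card +
        2 * (E.roots.toFinset.filter (fun t => 0 < t)).card + 1 := by
  classical
  set n : ℝ := (A.natDegree : ℝ) + E.natDegree with hn
  set ρ : ℝ := n / D with hρ
  set Fc := (A * E).map Complex.ofRealHom with hFc
  set Z := (A.map Complex.ofRealHom).roots + (E.map Complex.ofRealHom).roots with hZ
  set Sdisc : ι → Finset ℂ := fun i => (Fc.roots.filter fun z => dist z (ctr i) < rad i).toFinset with hSdisc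
  have hD0 : (0 : ℝ) < D := by exact_mod_cast hD
  have hnD : 4 * n ≤ D := le_trans hdeg (by nlinarith)
  have hρle : ρ ≤ 1 / 4 := by rw [hρ, div_le_iff₀ hD0]; linarith
  have hρ0 : 0 ≤ ρ := by positivity
  have hAc0 : A.map Complex.ofRealHom ≠ 0 := (Polynomial.map_ne_zero_iff Complex.ofRealHom.injective).mpr hA
  have hEc0 : E.map Complex.ofRealHom ≠ 0 := (Polynomial.map_ne_zero_iff Complex.ofRealHom.injective).mpr hE
  have hFc_eq : Fc = A.map Complex.ofRealHom * E.map Complex.ofRealHom := by rw [hFc, Polynomial.map_mul]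
  have hFc0 : Fc ≠ 0 := by rw [hFc_eq]; exact mul_ne_zero hAc0 hEc0
  have hZF : ∀ z, z ∈ Z ↔ z ∈ Fc.roots := by
    intro z
    rw [hZ, hFc_eq, Polynomial.roots_mul (mul_ne_zero hAc0 hEc0)]
  have hev : ∀ (Q : ℝ[X]) (x : ℝ), (Q.map Complex.ofRealHom).eval (x : ℂ) = ((Q.eval x : ℝ) : ℂ) := fun Q x => by
    rw [Polynomial.eval_map, ← Complex.ofRealHom_eq_coe, Polynomial.eval₂_at_apply, Complex.ofRealHom_eq_coe]
  -- a positive real root of `A` or `E` is an in-sector root of `Fc`, hence covered, hence in some `Sdisc i`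
  have hreal_in : ∀ t : ℝ, 0 < t → (A.eval t = 0 ∨ E.eval t = 0) → ∃ i ∈ I, (t : ℂ) ∈ Sdisc i := by
    intro t ht hAE
    have htZ : (t : ℂ) ∈ Z := by
      rw [hZ, Multiset.mem_add]
      rcases hAE with h | h
      · left; rw [Polynomial.mem_roots hAc0, Polynomial.IsRoot.def, hev, h, Complex.ofReal_zero]
      · right; rw [Polynomial.mem_roots hEc0, Polynomial.IsRoot.def, hev, h, Complex.ofReal_zero]
    obtain ⟨i, hi, hdist⟩ := hcover (t : ℂ) htZ (not_offSector_of_pos hs ht) t ht (by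
      rw [sub_self, norm_zero]; positivity)
    refine ⟨i, hi, ?_⟩
    rw [hSdisc]
    simp only [Multiset.mem_toFinset, Multiset.mem_filter]
    exact ⟨(hZF _).mp htZ, hdist⟩
  -- §a Rolle–Schur count
  by_cases hh0 : A + X ^ D * E = 0
  · rw [hh0, Polynomial.roots_zero]; simp
  have hRS := LacunarySymmetroidMatrixDescartes.RolleSchur.posRoots_le_scalar (A + X ^ D * E) E (D : ℝ) hh0
  rw [residual_graft_eq] at hRS
  set W : ℝ[X] := X * (derivative A * E - A * derivative E) - C (D : ℝ) * (A * E) with hW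
  set PE := E.roots.toFinset.filter (fun t => 0 < t) with hPE
  -- common positive roots of `h` and `E` are positive roots of `E`
  have hcommon : ((A + X ^ D * E).roots.toFinset.filter (fun x => 0 < x ∧ E.IsRoot x)).card ≤ PE.card := by
    refine Finset.card_le_card fun t ht => ?_
    rw [Finset.mem_filter] at ht
    rw [hPE, Finset.mem_filter, Multiset.mem_toFinset, Polynomial.mem_roots hE]
    exact ⟨ht.2.2, ht.2.1⟩
  -- §b positive roots of `W`: on the roots of `A·E` vs off them
  set ZW := W.roots.toFinset.filter (fun x => 0 < x) with hZW
  set T₁ := ZW.filter (fun x => A.eval x = 0 ∨ E.eval x = 0) with hT₁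
  set T₂ := ZW.filter (fun x => ¬ (A.eval x = 0 ∨ E.eval x = 0)) with hT₂
  have hZW_split : ZW.card = T₁.card + T₂.card := (Finset.card_filter_add_card_filter_not _).symm
  -- both inject into `⋃ᵢ Sdisc i` after casting to `ℂ`
  set U : Finset ℂ := I.biUnion Sdisc with hU
  have hUcard : U.card ≤ ∑ i ∈ I, (Sdisc i).card := Finset.card_biUnion_le
  have hT₁ : T₁.card ≤ U.card := by
    have : (T₁.image fun t : ℝ => (t : ℂ)) ⊆ U := by
      intro x hx
      rw [Finset.mem_image] at hx
      obtain ⟨t, ht, rfl⟩ := hx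
      rw [hT₁, Finset.mem_filter, hZW, Finset.mem_filter] at ht
      obtain ⟨i, hi, hmem⟩ := hreal_in t ht.1.2 ht.2
      exact Finset.mem_biUnion.mpr ⟨i, hi, hmem⟩
    calc T₁.card = (T₁.image fun t : ℝ => (t : ℂ)).card := (Finset.card_image_of_injective _ Complex.ofReal_injective).symm
      _ ≤ U.card := Finset.card_le_card this
  have hT₂ : T₂.card ≤ ∑ i ∈ I, (Sdisc i).card := by
    -- each point of `T₂` lies in some disc (localisation + coverage); inside disc `i` at most `#Sdisc i` of them (Rouché)
    have hmemT₂ : ∀ t ∈ T₂, 0 < t ∧ A.eval t ≠ 0 ∧ E.eval t ≠ 0 ∧ W.eval t = 0 := by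
      intro t ht
      rw [hT₂, Finset.mem_filter, hZW, Finset.mem_filter, Multiset.mem_toFinset] at ht
      obtain ⟨⟨hWt, hpos⟩, hAE⟩ := ht
      push Not at hAE
      exact ⟨hpos, hAE.1, hAE.2, (Polynomial.mem_roots'.mp hWt).2⟩
    have hT₂cover : ∀ t ∈ T₂, ∃ i ∈ I, dist (t : ℂ) (ctr i) < rad i := by
      intro t ht
      obtain ⟨hpos, hAt, hEt, hWt⟩ := hmemT₂ t ht
      obtain ⟨z, hz, hzin, hclose⟩ := exists_inSector_root_near_of_residual_zero hs hs1 A E hD hdeg hpos hAt hEt hWt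
      refine hcover z hz hzin t hpos ?_
      -- `‖t − z‖ ≤ 2ρ t` and `t ≤ ‖z‖ + ‖t − z‖` give `‖t − z‖ ≤ 4ρ‖z‖` (ρ ≤ 1/4)
      have htz : (t : ℝ) ≤ ‖z‖ + ‖(t : ℂ) - z‖ := by
        have := norm_le_norm_add_norm_sub' (t : ℂ) z
        rw [Complex.norm_real, Real.norm_eq_abs, abs_of_pos hpos] at this
        linarith [norm_sub_rev (t : ℂ) z]
      have h2 : ‖(t : ℂ) - z‖ ≤ 2 * ρ * t := by rw [hρ]; linarith
      nlinarith [norm_nonneg ((t : ℂ) - z), norm_nonneg z]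
    -- split `T₂` by discs
    have hsub : T₂ ⊆ I.biUnion fun i => T₂.filter fun t => dist (t : ℂ) (ctr i) < rad i := by
      intro t ht
      obtain ⟨i, hi, hd⟩ := hT₂cover t ht
      exact Finset.mem_biUnion.mpr ⟨i, hi, Finset.mem_filter.mpr ⟨ht, hd⟩⟩
    refine (Finset.card_le_card hsub).trans (Finset.card_biUnion_le.trans (Finset.sum_le_sum fun i hi => ?_))
    refine card_real_zeros_residual_le_in_disc A E D hA hE (ctr i) (hrad i hi) (fun τ hτ => ?_) _ (fun t ht => ?_)
    · exact rouche_ineq_of_clearance A E hA hE hD hnD (h0 i hi τ hτ) (hclear i hi τ hτ)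
    · rw [Finset.mem_filter] at ht
      obtain ⟨hpos, hAt, hEt, hWt⟩ := hmemT₂ t ht.1
      exact ⟨ht.2, hAt, hEt, hWt⟩
  -- §c assembly
  have hZW_le : ZW.card ≤ 2 * ∑ i ∈ I, (Sdisc i).card := by omega
  have hig : ∑ i ∈ I, ((Fc.roots.filter fun z => dist z (ctr i) < rad i).toFinset.card) = ∑ i ∈ I, (Sdisc i).card := rfl
  rw [hig]
  omega


/-- **T1, SHARP INTERFACE (Rouché discs supplied with their inequality).**  `A, E ∈ ℝ[X]` non-zero; discs `B(ctr i, rad i)` on whose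
circles the Rouché inequality `‖W + D·AE‖ < ‖D·AE‖` holds (e.g. via `rouche_ineq_of_rootSum_norm_lt` from any estimate
`‖Σ_A τ/(τ−z) − Σ_E τ/(τ−z)‖ < D`), and which contain every positive zero of the residual `W` off the roots of `A·E`.  Then
`Z₊(A + X^D·E) ≤ Σᵢ #{distinct roots of A·E in disc i} + Z₊(A) + 3·Z₊(E) + 1`.  (No steepness hypothesis appears: it is whatever the
consumer used to establish the two disc hypotheses.) [this work] -/
theorem card_posRoots_add_X_pow_mul_le_of_rouche_discs (A E : ℝ[X]) (D : ℕ) (hA : A ≠ 0) (hE : E ≠ 0)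
    {ι : Type*} (I : Finset ι) (ctr : ι → ℂ) (rad : ι → ℝ) (hrad : ∀ i ∈ I, 0 < rad i)
    (hbd : ∀ i ∈ I, ∀ τ ∈ Metric.sphere (ctr i) (rad i),
      ‖((X * (derivative A * E - A * derivative E) - C (D : ℝ) * (A * E)).map Complex.ofRealHom +
          C (D : ℂ) * ((A * E).map Complex.ofRealHom)).eval τ‖ <
        ‖(C (D : ℂ) * ((A * E).map Complex.ofRealHom)).eval τ‖)
    (hcovW : ∀ t : ℝ, 0 < t → A.eval t ≠ 0 → E.eval t ≠ 0 →
      (X * (derivative A * E - A * derivative E) - C (D : ℝ) * (A * E)).eval t = 0 → ∃ i ∈ I, dist (t : ℂ) (ctr i) < rad i) :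
    ((A + X ^ D * E).roots.toFinset.filter (fun t => 0 < t)).card ≤
      ∑ i ∈ I, (((A * E).map Complex.ofRealHom).roots.filter fun z => dist z (ctr i) < rad i).toFinset.card +
        (A.roots.toFinset.filter (fun t => 0 < t)).card + 3 * (E.roots.toFinset.filter (fun t => 0 < t)).card + 1 := by
  classical
  by_cases hh0 : A + X ^ D * E = 0
  · rw [hh0, Polynomial.roots_zero]; simp
  have hRS := LacunarySymmetroidMatrixDescartes.RolleSchur.posRoots_le_scalar (A + X ^ D * E) E (D : ℝ) hh0
  rw [residual_graft_eq] at hRS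
  set W : ℝ[X] := X * (derivative A * E - A * derivative E) - C (D : ℝ) * (A * E) with hW
  set PA := A.roots.toFinset.filter (fun t => 0 < t) with hPA
  set PE := E.roots.toFinset.filter (fun t => 0 < t) with hPE
  have hcommon : ((A + X ^ D * E).roots.toFinset.filter (fun x => 0 < x ∧ E.IsRoot x)).card ≤ PE.card := by
    refine Finset.card_le_card fun t ht => ?_
    rw [Finset.mem_filter] at ht
    rw [hPE, Finset.mem_filter, Multiset.mem_toFinset, Polynomial.mem_roots hE]
    exact ⟨ht.2.2, ht.2.1⟩
  set ZW := W.roots.toFinset.filter (fun x => 0 < x) with hZW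
  set T₁ := ZW.filter (fun x => A.eval x = 0 ∨ E.eval x = 0) with hT₁
  set T₂ := ZW.filter (fun x => ¬ (A.eval x = 0 ∨ E.eval x = 0)) with hT₂
  have hZW_split : ZW.card = T₁.card + T₂.card := (Finset.card_filter_add_card_filter_not _).symm
  have hT₁ : T₁.card ≤ PA.card + PE.card := by
    calc T₁.card ≤ (PA ∪ PE).card := by
          refine Finset.card_le_card fun t ht => ?_
          rw [hT₁, Finset.mem_filter, hZW, Finset.mem_filter] at ht
          rcases ht.2 with h | h
          · exact Finset.mem_union_left _ (by
              rw [hPA, Finset.mem_filter, Multiset.mem_toFinset, Polynomial.mem_roots hA]; exact ⟨h, ht.1.2⟩)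
          · exact Finset.mem_union_right _ (by
              rw [hPE, Finset.mem_filter, Multiset.mem_toFinset, Polynomial.mem_roots hE]; exact ⟨h, ht.1.2⟩)
      _ ≤ PA.card + PE.card := Finset.card_union_le _ _
  have hT₂ : T₂.card ≤ ∑ i ∈ I, (((A * E).map Complex.ofRealHom).roots.filter fun z => dist z (ctr i) < rad i).toFinset.card := by
    have hmemT₂ : ∀ t ∈ T₂, 0 < t ∧ A.eval t ≠ 0 ∧ E.eval t ≠ 0 ∧ W.eval t = 0 := by
      intro t ht
      rw [hT₂, Finset.mem_filter, hZW, Finset.mem_filter, Multiset.mem_toFinset] at ht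
      obtain ⟨⟨hWt, hpos⟩, hAE⟩ := ht
      push Not at hAE
      exact ⟨hpos, hAE.1, hAE.2, (Polynomial.mem_roots'.mp hWt).2⟩
    have hsub : T₂ ⊆ I.biUnion fun i => T₂.filter fun t => dist (t : ℂ) (ctr i) < rad i := by
      intro t ht
      obtain ⟨hpos, hAt, hEt, hWt⟩ := hmemT₂ t ht
      obtain ⟨i, hi, hd⟩ := hcovW t hpos hAt hEt hWt
      exact Finset.mem_biUnion.mpr ⟨i, hi, Finset.mem_filter.mpr ⟨ht, hd⟩⟩
    refine (Finset.card_le_card hsub).trans (Finset.card_biUnion_le.trans (Finset.sum_le_sum fun i hi => ?_))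
    refine card_real_zeros_residual_le_in_disc A E D hA hE (ctr i) (hrad i hi) (hbd i hi) _ (fun t ht => ?_)
    rw [Finset.mem_filter] at ht
    obtain ⟨hpos, hAt, hEt, hWt⟩ := hmemT₂ t ht.1
    exact ⟨ht.2, hAt, hEt, hWt⟩
  omega

end Assembly

end Summit.ValiantsHypothesis.ValiantsHypothesis.Theorems.KPlusLogSqLaw.TowerGraft
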